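import Mathlib

/-!
# Near-field certificate algebra (crux `PhononSlackCertificates.NearFieldConvexity`, stmt-AtomisticToContinuum-13958)

Helper identities for the registered stub `stub_certificateOnChartsRef` (line `Sketch`, design memo D4/D7 of the
line card `Cruxes/NearFieldConvexity/Lines/Sketch.md`): the pointwise local certificate asks for an ANTISYMMETRIC
transfer `τ` with `0 ≤ E_s + Σ_j τ s j` at interior sites, where `E_s = ½ Σ_{k ≠ s} W s k` is the self-site energy of
a symmetric pair functional `W`.  Every proof along the frame-free cluster-functional format (idea card
`frame-free-star-certificate`) produces instead CLUSTER FUNCTIONALS `G_s = ½ Σ_{j,k} g s j k` from a decomposition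
`Σ_s g s j k = W j k` of every pair energy among the clusters, and a calibration of each cluster by a SELF-STRESS of
the reference framework.  This file proves the two pieces of pure algebra that connect the formats:

* `transfer_antisymm`, `selfEnergy_add_transfer_eq` — **transfer bookkeeping (D7)**: the explicit transfer
  `τ s j = ½ Σ_k (g s j k − g j s k)` is antisymmetric and turns the self-site energy into the cluster functional,
  `½ Σ_{k ∈ Ω ∖ s} W s k + Σ_{j ∈ Ω} τ s j = ½ Σ_{j ∈ Ω} Σ_{k ∈ Ω} g s j k`, exactly; `transfer_eq_zero_of_vanishing`
  records its locality (no transfer between two sites none of whose cluster terms involve the other).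
* `selfStress_linear_term_eq_zero`, `selfStress_sqDist_expansion` — **self-stresses kill the linear term (D4)**:
  if `Σ_j σ i j • (X i − X j) = 0` at every node (`σ` symmetric), then for every displacement `u`
  `Σ_{i,j} σ i j ⟪X i − X j, u i − u j⟫ = 0`, hence
  `Σ_{i,j} σ i j (‖(X i + u i) − (X j + u j)‖² − ‖X i − X j‖²) = Σ_{i,j} σ i j ‖u i − u j‖²` with NO smallness
  assumption — the calibrated cluster functional is frame-free and starts at second order.

Everything is finite-dimensional algebra over `Finset` sums in a real inner-product space; nothing is specific to
Lennard-Jones.  [folklore]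
-/

noncomputable section

open scoped BigOperators
open Finset

namespace Summit.AtomisticToContinuum.Crystallization.Theorems.PhononSlackNearFieldConvexity

/-! ### Transfer bookkeeping (D7) -/

section Transfer

variable {ι : Type*}

/-- **The explicit transfer is antisymmetric**: with `τ s j = ½ Σ_{k∈Ω} (g s j k − g j s k)`,
`τ s j = −τ j s`. [folklore] -/
theorem transfer_antisymm (Ω : Finset ι) (g : ι → ι → ι → ℝ) (s j : ι) :
    (1 / 2 : ℝ) * (∑ k ∈ Ω, (g s j k - g j s k)) = -((1 / 2 : ℝ) * (∑ k ∈ Ω, (g j s k - g s j k))) := by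
  rw [← mul_neg, ← Finset.sum_neg_distrib]
  congr 1
  refine Finset.sum_congr rfl fun k _ => ?_
  ring

/-- **Transfer bookkeeping (design step D7 of the near-field certificate).**  Let `W` be a pair functional
on the finite region `Ω` and `g s j k` a decomposition of each pair energy among the clusters `s ∈ Ω`
(`Σ_{s∈Ω} g s j k = W j k` for `j ≠ k` in `Ω`) with no diagonal terms (`g s j j = 0`; symmetry of `g`
in the pair is not even needed).  Then the explicit antisymmetric transfer `τ s j = ½ Σ_{k∈Ω} (g s j k − g j s k)`
converts the self-site energy `½ Σ_{k ∈ Ω ∖ s} W s k` into the cluster functional: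
`½ Σ_{k∈Ω∖s} W s k + Σ_{j∈Ω} τ s j = ½ Σ_{j∈Ω} Σ_{k∈Ω} g s j k`. [folklore] -/
theorem selfEnergy_add_transfer_eq [DecidableEq ι] (Ω : Finset ι) (W : ι → ι → ℝ) (g : ι → ι → ι → ℝ)
    (hdec : ∀ j ∈ Ω, ∀ k ∈ Ω, j ≠ k → ∑ s ∈ Ω, g s j k = W j k)
    (hdiag : ∀ s ∈ Ω, ∀ j ∈ Ω, g s j j = 0) {s : ι} (hs : s ∈ Ω) :
    (1 / 2 : ℝ) * (∑ k ∈ Ω.erase s, W s k) + ∑ j ∈ Ω, (1 / 2 : ℝ) * (∑ k ∈ Ω, (g s j k - g j s k)) =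
      (1 / 2 : ℝ) * ∑ j ∈ Ω, ∑ k ∈ Ω, g s j k := by
  -- split the transfer into its two halves
  have hsplit : ∑ j ∈ Ω, (1 / 2 : ℝ) * (∑ k ∈ Ω, (g s j k - g j s k)) =
      (1 / 2 : ℝ) * (∑ j ∈ Ω, ∑ k ∈ Ω, g s j k) - (1 / 2 : ℝ) * (∑ j ∈ Ω, ∑ k ∈ Ω, g j s k) := by
    rw [← Finset.mul_sum, ← mul_sub, ← Finset.sum_sub_distrib]
    congr 1
    refine Finset.sum_congr rfl fun j _ => ?_
    rw [Finset.sum_sub_distrib]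
  -- the second half is the self-site energy: swap the sums and use the decomposition on `k ≠ s`
  have hswap : ∑ j ∈ Ω, ∑ k ∈ Ω, g j s k = ∑ k ∈ Ω, ∑ j ∈ Ω, g j s k := Finset.sum_comm
  have hsecond : ∑ k ∈ Ω, ∑ j ∈ Ω, g j s k = ∑ k ∈ Ω.erase s, W s k := by
    rw [← Finset.sum_erase_add Ω _ hs]
    have h0 : ∑ j ∈ Ω, g j s s = 0 := Finset.sum_eq_zero fun j hj => hdiag j hj s hs
    rw [h0, add_zero]
    refine Finset.sum_congr rfl fun k hk => ?_
    have hk' : k ∈ Ω := Finset.mem_of_mem_erase hk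
    have hks : k ≠ s := Finset.ne_of_mem_erase hk
    exact hdec s hs k hk' hks.symm
  rw [hsplit, hswap, hsecond]
  ring

/-- **Locality of the explicit transfer.**  If no cluster term of `s` involves `j` and no cluster term of `j`
involves `s` (`g s j k = 0` and `g j s k = 0` for all `k ∈ Ω`), then `τ s j = 0`. [folklore] -/
theorem transfer_eq_zero_of_vanishing (Ω : Finset ι) (g : ι → ι → ι → ℝ) {s j : ι}
    (h₁ : ∀ k ∈ Ω, g s j k = 0) (h₂ : ∀ k ∈ Ω, g j s k = 0) :
    (1 / 2 : ℝ) * (∑ k ∈ Ω, (g s j k - g j s k)) = 0 := by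
  rw [Finset.sum_eq_zero fun k hk => by rw [h₁ k hk, h₂ k hk, sub_zero], mul_zero]

/-- **Crude size of the explicit transfer**: `|τ s j| ≤ ½ Σ_k (|g s j k| + |g j s k|)`. [folklore] -/
theorem abs_transfer_le (Ω : Finset ι) (g : ι → ι → ι → ℝ) (s j : ι) :
    |(1 / 2 : ℝ) * (∑ k ∈ Ω, (g s j k - g j s k))| ≤ (1 / 2 : ℝ) * ∑ k ∈ Ω, (|g s j k| + |g j s k|) := by
  rw [abs_mul, abs_of_pos (by norm_num : (0 : ℝ) < 1 / 2)]
  refine mul_le_mul_of_nonneg_left ((Finset.abs_sum_le_sum_abs _ _).trans (Finset.sum_le_sum fun k _ => ?_))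
    (by norm_num)
  exact abs_sub _ _

end Transfer

/-! ### Self-stresses kill the linear term (D4) -/

section SelfStress

variable {ι : Type*} {E : Type*} [NormedAddCommGroup E] [InnerProductSpace ℝ E]

/-- **A self-stress annihilates every displacement at first order.**  If `σ` is symmetric and in equilibrium
at every node of the finite framework (`Σ_{j∈S} σ i j • (X i − X j) = 0` for `i ∈ S`), then
`Σ_{i∈S} Σ_{j∈S} σ i j ⟪X i − X j, u i − u j⟫ = 0` for every `u`. [folklore] -/
theorem selfStress_linear_term_eq_zero (S : Finset ι) (σ : ι → ι → ℝ) (X u : ι → E)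
    (hsymm : ∀ i ∈ S, ∀ j ∈ S, σ i j = σ j i)
    (heq : ∀ i ∈ S, ∑ j ∈ S, σ i j • (X i - X j) = 0) :
    ∑ i ∈ S, ∑ j ∈ S, σ i j * inner ℝ (X i - X j) (u i - u j) = 0 := by
  -- `⟪X i − X j, u i − u j⟫ = ⟪X i − X j, u i⟫ − ⟪X i − X j, u j⟫`; the first part vanishes row-wise by
  -- equilibrium at `i`, the second column-wise by equilibrium at `j` after the symmetry `σ i j = σ j i`.
  have hrow : ∀ i ∈ S, ∑ j ∈ S, σ i j * inner ℝ (X i - X j) (u i) = 0 := by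
    intro i hi
    have : ∑ j ∈ S, σ i j * inner ℝ (X i - X j) (u i) = inner ℝ (∑ j ∈ S, σ i j • (X i - X j)) (u i) := by
      rw [sum_inner]
      refine Finset.sum_congr rfl fun j _ => ?_
      rw [real_inner_smul_left]
    rw [this, heq i hi, inner_zero_left]
  have hcol : ∀ j ∈ S, ∑ i ∈ S, σ i j * inner ℝ (X i - X j) (u j) = 0 := by
    intro j hj
    have : ∑ i ∈ S, σ i j * inner ℝ (X i - X j) (u j) = -∑ i ∈ S, σ j i * inner ℝ (X j - X i) (u j) := by
      rw [← Finset.sum_neg_distrib]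
      refine Finset.sum_congr rfl fun i hi => ?_
      rw [hsymm i hi j hj, ← neg_sub (X j) (X i), inner_neg_left]
      ring
    rw [this, hrow j hj, neg_zero]
  calc ∑ i ∈ S, ∑ j ∈ S, σ i j * inner ℝ (X i - X j) (u i - u j)
      = ∑ i ∈ S, ∑ j ∈ S, (σ i j * inner ℝ (X i - X j) (u i) - σ i j * inner ℝ (X i - X j) (u j)) := by
        refine Finset.sum_congr rfl fun i _ => Finset.sum_congr rfl fun j _ => ?_
        rw [inner_sub_right, mul_sub]
    _ = ∑ i ∈ S, ∑ j ∈ S, σ i j * inner ℝ (X i - X j) (u i) -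
          ∑ j ∈ S, ∑ i ∈ S, σ i j * inner ℝ (X i - X j) (u j) := by
        simp only [Finset.sum_sub_distrib]
        congr 1
        exact Finset.sum_comm
    _ = 0 := by
        rw [Finset.sum_eq_zero hrow, Finset.sum_eq_zero hcol, sub_zero]

/-- **Frame-free second-order start of the calibrated functional (D4).**  For a symmetric self-stress `σ` of the
reference framework `X`, the `σ`-weighted change of the SQUARED edge lengths under any displacement `u` is exactly
the `σ`-weighted sum of `‖u i − u j‖²`:
`Σ_{i,j} σ i j (‖(X i + u i) − (X j + u j)‖² − ‖X i − X j‖²) = Σ_{i,j} σ i j ‖u i − u j‖²` — no smallness of `u`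
is needed. [folklore] -/
theorem selfStress_sqDist_expansion (S : Finset ι) (σ : ι → ι → ℝ) (X u : ι → E)
    (hsymm : ∀ i ∈ S, ∀ j ∈ S, σ i j = σ j i)
    (heq : ∀ i ∈ S, ∑ j ∈ S, σ i j • (X i - X j) = 0) :
    ∑ i ∈ S, ∑ j ∈ S, σ i j * (‖(X i + u i) - (X j + u j)‖ ^ 2 - ‖X i - X j‖ ^ 2) =
      ∑ i ∈ S, ∑ j ∈ S, σ i j * ‖u i - u j‖ ^ 2 := by
  have hlin := selfStress_linear_term_eq_zero S σ X u hsymm heq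
  have hexp : ∀ i j, ‖(X i + u i) - (X j + u j)‖ ^ 2 - ‖X i - X j‖ ^ 2 =
      2 * inner ℝ (X i - X j) (u i - u j) + ‖u i - u j‖ ^ 2 := by
    intro i j
    have : (X i + u i) - (X j + u j) = (X i - X j) + (u i - u j) := by abel
    rw [this, norm_add_sq_real]
    ring
  calc ∑ i ∈ S, ∑ j ∈ S, σ i j * (‖(X i + u i) - (X j + u j)‖ ^ 2 - ‖X i - X j‖ ^ 2)
      = ∑ i ∈ S, ∑ j ∈ S, (2 * (σ i j * inner ℝ (X i - X j) (u i - u j)) + σ i j * ‖u i - u j‖ ^ 2) := by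
        refine Finset.sum_congr rfl fun i _ => Finset.sum_congr rfl fun j _ => ?_
        rw [hexp]; ring
    _ = 2 * (∑ i ∈ S, ∑ j ∈ S, σ i j * inner ℝ (X i - X j) (u i - u j)) +
          ∑ i ∈ S, ∑ j ∈ S, σ i j * ‖u i - u j‖ ^ 2 := by
        rw [Finset.mul_sum, ← Finset.sum_add_distrib]
        refine Finset.sum_congr rfl fun i _ => ?_
        rw [Finset.mul_sum, ← Finset.sum_add_distrib]
    _ = ∑ i ∈ S, ∑ j ∈ S, σ i j * ‖u i - u j‖ ^ 2 := by rw [hlin, mul_zero, zero_add]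

/-- **Self-stresses survive affine maps of the reference** (so the calibrated functional has no linear term at a
homogeneously strained template either): if `σ` is in equilibrium for `X`, it is in equilibrium for `L ∘ X + c`
for every linear map `L` and translation `c`. [folklore] -/
theorem selfStress_affine {F : Type*} [AddCommGroup F] [Module ℝ F] (S : Finset ι) (σ : ι → ι → ℝ) (X : ι → E)
    (L : E →ₗ[ℝ] F) (c : F) (heq : ∀ i ∈ S, ∑ j ∈ S, σ i j • (X i - X j) = 0) :
    ∀ i ∈ S, ∑ j ∈ S, σ i j • ((L (X i) + c) - (L (X j) + c)) = 0 := by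
  intro i hi
  have : ∀ j, (L (X i) + c) - (L (X j) + c) = L (X i - X j) := fun j => by rw [map_sub]; abel
  simp_rw [this, ← map_smul, ← map_sum, heq i hi, map_zero]

end SelfStress

end Summit.AtomisticToContinuum.Crystallization.Theorems.PhononSlackNearFieldConvexity

/-! ### Registered headline forms (index type `Fin N`, ambient space `ℝ³`) -/

namespace Summit.AtomisticToContinuum.Crystallization.Theorems.PhononSlackNearFieldConvexity

/-- **Registered helper `stub_transferBookkeeping`** (the `Fin N` instance of `selfEnergy_add_transfer_eq` used by
the certificate stub: pair energies `W`, cluster decomposition `g`, region `Ω`). [folklore] -/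
theorem stub_transferBookkeeping : ∀ (N : ℕ) (Ω : Finset (Fin N)) (W : Fin N → Fin N → ℝ) (g : Fin N → Fin N → Fin N → ℝ), (∀ j ∈ Ω, ∀ k ∈ Ω, j ≠ k → ∑ s ∈ Ω, g s j k = W j k) → (∀ s ∈ Ω, ∀ j ∈ Ω, g s j j = 0) → ∀ s ∈ Ω, (1 / 2 : ℝ) * (∑ k ∈ Ω.erase s, W s k) + ∑ j ∈ Ω, (1 / 2 : ℝ) * (∑ k ∈ Ω, (g s j k - g j s k)) = (1 / 2 : ℝ) * ∑ j ∈ Ω, ∑ k ∈ Ω, g s j k :=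
  fun _ Ω W g hdec hdiag _ hs => selfEnergy_add_transfer_eq Ω W g hdec hdiag hs

/-- **Registered helper `stub_selfStressExpansion`** (the `ℝ³`, `Fin n` instance of `selfStress_sqDist_expansion`:
a symmetric self-stress of a finite reference cluster kills the linear term of the squared-edge-length changes).
[folklore] -/
theorem stub_selfStressExpansion : ∀ (n : ℕ) (S : Finset (Fin n)) (σ : Fin n → Fin n → ℝ) (X u : Fin n → EuclideanSpace ℝ (Fin 3)), (∀ i ∈ S, ∀ j ∈ S, σ i j = σ j i) → (∀ i ∈ S, ∑ j ∈ S, σ i j • (X i - X j) = 0) → ∑ i ∈ S, ∑ j ∈ S, σ i j * (‖(X i + u i) - (X j + u j)‖ ^ 2 - ‖X i - X j‖ ^ 2) = ∑ i ∈ S, ∑ j ∈ S, σ i j * ‖u i - u j‖ ^ 2 :=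
  fun _ S σ X u hsymm heq => selfStress_sqDist_expansion S σ X u hsymm heq

end Summit.AtomisticToContinuum.Crystallization.Theorems.PhononSlackNearFieldConvexity
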